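import Summits.BirchSwinnertonDyer.BirchSwinnertonDyer.Theorems.ByReductionTypeAtTwoOrdKatoHalfAtTwoIsoChebotarevTranspositionSignFree
import Literature.NumberTheory.GaloisRepresentations.ModNCyclotomicCharacter
import Literature.NumberTheory.GaloisRepresentations.CyclotomicLevels
import HarnessLib

/-!
# Route ByReductionTypeAtTwo, crux `OrdKatoHalfAtTwoIso` (stmt-BirchSwinnertonDyer-19573), line `steinberg-fibre-at-two`
# (skeleton v11), child `OrdKatoIntSurjectiveAtTwo` = CoreA⁺ `CoreTheoremAPosDiscTwo` (stmt-BirchSwinnertonDyer-23967):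
# plan item (P3) of the lead's `STUB-BRIEF-stub_coreA_posDisc.md` — `μ₄`-BOOKKEEPING AND THE INDEX-2 DESCENT OF THE
# STEINBERG–SAH INPUT TO `Gal(ℚ̄/ℚ(i))` (first of two files of (H-C)⁺, the transposition prime `q ≡ 1 (mod 4)`)

Seat `cruxlead-stmt-BirchSwinnertonDyer-19573-w2` (prover WIDTH under the lead cruxlead-19573 g5; HOME
`run/shared/lean/pub/bsd-2adic/`; `--supports` stmt-BirchSwinnertonDyer-23967). THEOREMS ONLY (no definition, no named fact,
no `sorry`, no instance). HONEST FRAMING (cell bsd-2adic): BSD is not proved by any of this; neither the crux nor CoreA⁺ is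
proved here.

WHY. On `0 < Δ` the Kolyvagin cocycle of a tame prime `ℓ` has vanishing real component exactly when `4 ∣ ℓ − 1`
(`…KolyvaginCocycleInvolution.lean` p687675 / `…KolyvaginRealComponent.lean`, lead g5), so the `0 < Δ` assembly needs
socket 1's transposition prime (H-C) with the extra conjunct `4 ∣ ℓ(q) − 1`, i.e. `Frob_q ∈ Gal(ℚ̄/ℚ(i))`. The companion
`…ChebotarevTranspositionPosDisc.lean` runs p681540's (H-C) engine inside `Gal(ℚ̄/ℚ(i))`; this file supplies its two
inputs:

* §1 `μ₄` over `ℚ`: `t⁴ = 1 ⇒ t ∈ {±1, ±i}` (`eq_of_pow_four_eq_one`); an element fixing `i` lies in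
  `rootsOfUnityFixer ℚ 4 = Gal(ℚ̄/ℚ(i))` (`mem_rootsOfUnityFixer_four_of_smul_eq`); `(ℤ/4)ˣ = {±1}`, so two elements off
  `Gal(ℚ̄/ℚ(i))` differ by one in it (`mul_inv_mem_rootsOfUnityFixer_four_of_not_mem`); normality; and
  `four_dvd_primesEquiv_sub_one_of_mem_rootsOfUnityFixer_four` — an arithmetic Frobenius at `𝔓 ∣ q`, `q ∤ 2`, lying in
  `Gal(ℚ̄/ℚ(i))` forces `4 ∣ ℓ(q) − 1` (`χ₄(Fr) = ℓ`, tree `modNCyclotomicCharacter_eq_residueCard_of_isArithFrobAt`).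
* §2 `exists_mem_inf_rootsOfUnityFixer_four_apply_ne_zero` — INDEX-2 DESCENT: for `ρ̄_{E,2}` onto, a continuous
  `1`-cocycle `φ₀` of `E[2]` not vanishing on `M = ker ρ̄₂ ⊓ ker κ` does not vanish on `M ⊓ Gal(ℚ̄/ℚ(i))` (else
  `φ₀(M) = {0, v}` with `v ≠ 0` fixed by all of `Γ_ℚ` — `g • v = φ₀(g ν₁ g⁻¹)` — while a `3`-cycle of `E[2]` moves `v`).
  So the sign-free Steinberg–Sah inputs of p681540 §1 descend for free; no new Sah engine.

References: B. Mazur, K. Rubin, Mem. AMS 799 (2004) §3.6 [MazurRubin2004]; J.-P. Serre, *Local Fields* (1979) VII §5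
[SerreLocalFields1979]; L. C. Washington (1997) Lemma 2.12 ff. [Washington1997]; J. Neukirch, *Algebraic Number Theory*
(1999) I (10.3) [NeukirchANT1999]; tree `ModNCyclotomicCharacter.lean`, `CyclotomicLevels.lean`, p681540, p658151.
-/

set_option autoImplicit false
set_option linter.dupNamespace false

noncomputable section

open scoped NumberField
open Field WeierstrassCurve Function IsDedekindDomain NumberField
open Literature.NumberTheory.EllipticCurves Literature.NumberTheory.GaloisRepresentations
open Literature.NumberTheory.EllipticCurves.DokchitserDokchitser2012
open Summit.BirchSwinnertonDyer.BirchSwinnertonDyer.Rank1Residual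
open Rat.HeightOneSpectrum

-- D-0017: single-problem summit, so `Summit.BirchSwinnertonDyer.BirchSwinnertonDyer.…` repeats a namespace BY DESIGN.
namespace Summit.BirchSwinnertonDyer.BirchSwinnertonDyer.Theorems.SteinbergFibreAtTwo

/-! ## §1 `μ₄` over `ℚ`: fourth roots of unity, `Gal(ℚ̄/ℚ(i))`, and `Frob_q ∈ Gal(ℚ̄/ℚ(i)) ⇒ 4 ∣ ℓ − 1` -/

section MuFour

/-- The fourth roots of unity of `ℚ̄` are `±1, ±i` (`i² = −1`): `t⁴ − 1 = (t² − 1)(t² + 1)`. [folklore] -/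
theorem eq_of_pow_four_eq_one {i t : AlgebraicClosure ℚ} (hi : i ^ 2 = -1) (ht : t ^ 4 = 1) :
    t = 1 ∨ t = -1 ∨ t = i ∨ t = -i := by
  have ht2 : (t ^ 2) ^ 2 = 1 := by rw [← pow_mul]; exact ht
  rcases sq_eq_one_iff.mp ht2 with h | h
  · rcases sq_eq_one_iff.mp h with h1 | h1
    · exact Or.inl h1
    · exact Or.inr (Or.inl h1)
  · rw [← hi] at h
    rcases eq_or_eq_neg_of_sq_eq_sq t i h with h1 | h1
    · exact Or.inr (Or.inr (Or.inl h1))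
    · exact Or.inr (Or.inr (Or.inr h1))

/-- **An element of `Γ_ℚ` fixing `i = √−1` fixes every fourth root of unity**, i.e. lies in
`rootsOfUnityFixer ℚ 4 = Gal(ℚ̄/ℚ(μ₄)) = Gal(ℚ̄/ℚ(i))`. [folklore] -/
theorem mem_rootsOfUnityFixer_four_of_smul_eq {τ : absoluteGaloisGroup ℚ} {i : AlgebraicClosure ℚ}
    (hi : i ^ 2 = -1) (hτ : τ • i = i) : τ ∈ rootsOfUnityFixer ℚ 4 := by
  rw [mem_rootsOfUnityFixer_iff]
  intro t ht
  rcases eq_of_pow_four_eq_one hi ht with rfl | rfl | rfl | rfl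
  · exact smul_one τ
  · rw [smul_neg, smul_one]
  · exact hτ
  · rw [smul_neg, hτ]

/-- `(ℤ/4)ˣ = {1, −1}`. [folklore] -/
theorem units_zmod_four_eq_one_or_eq_neg_one : ∀ u : (ZMod 4)ˣ, u = 1 ∨ u = -1 := by
  decide

/-- `Gal(ℚ̄/ℚ(μ₄))` is normal in `Γ_ℚ` (the kernel of the mod-`4` cyclotomic character). [folklore] -/
theorem normal_rootsOfUnityFixer_four : (rootsOfUnityFixer ℚ 4).Normal := by
  haveI : NeZero ((4 : ℕ) : ℚ) := ⟨by norm_num⟩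
  rw [rootsOfUnityFixer_eq_ker]
  infer_instance

/-- **`Gal(ℚ̄/ℚ(i))` has index (at most) two**: two elements of `Γ_ℚ` off it differ by an element of it
(`χ₄(g) = χ₄(h) = −1` in `(ℤ/4)ˣ = {±1}`). [folklore] -/
theorem mul_inv_mem_rootsOfUnityFixer_four_of_not_mem {g h : absoluteGaloisGroup ℚ}
    (hg : g ∉ rootsOfUnityFixer ℚ 4) (hh : h ∉ rootsOfUnityFixer ℚ 4) :
    g * h⁻¹ ∈ rootsOfUnityFixer ℚ 4 := by
  haveI : NeZero ((4 : ℕ) : ℚ) := ⟨by norm_num⟩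
  rw [rootsOfUnityFixer_eq_ker, MonoidHom.mem_ker] at hg hh ⊢
  rw [map_mul, map_inv, (units_zmod_four_eq_one_or_eq_neg_one _).resolve_left hg,
    (units_zmod_four_eq_one_or_eq_neg_one _).resolve_left hh, mul_inv_cancel]

/-- `N(v) = ℓ(v)`: the residue cardinality of the finite place `v` of `ℚ` is its rational prime (Mathlib's
`Rat.HeightOneSpectrum.primesEquiv`). [folklore] -/
private theorem residueCard_eq_coe_primesEquiv (v : HeightOneSpectrum (𝓞 ℚ)) :
    v.residueCard = ((primesEquiv v : Nat.Primes) : ℕ) := by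
  change Ideal.absNorm v.asIdeal = natGenerator v
  set e : 𝓞 ℚ ≃+* ℤ := Rat.IsIntegralClosure.intEquiv (𝓞 ℚ) with he
  have h1 : Nat.card (𝓞 ℚ ⧸ v.asIdeal) = Nat.card (ℤ ⧸ v.asIdeal.map e) :=
    Nat.card_congr (Ideal.quotientEquiv v.asIdeal (v.asIdeal.map e) e rfl).toEquiv
  rw [Ideal.absNorm_apply, Submodule.cardQuot_apply, h1, ← Submodule.cardQuot_apply,
    ← Ideal.absNorm_apply, ← span_natGenerator, Ideal.absNorm_span_natCast, Module.finrank_self,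
    pow_one]

/-- **`Frob_q ∈ Gal(ℚ̄/ℚ(i))` forces `q ≡ 1 (mod 4)`.** For a finite place `q ∤ 2` of `ℚ` with rational prime `ℓ`, a prime
`𝔓 ∣ q` of `ℤ̄` and an arithmetic Frobenius `Fr` at `𝔓` lying in `rootsOfUnityFixer ℚ 4`: `4 ∣ ℓ − 1`. Indeed
`χ₄(Fr) = ℓ (mod 4)` (`modNCyclotomicCharacter_eq_residueCard_of_isArithFrobAt`, `4 ∉ 𝔓` as `ℓ ≠ 2`) and `χ₄(Fr) = 1`.
[cite: Washington1997, Lemma 2.12 ff.] [cite: NeukirchANT1999, Ch. I (10.3)] -/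
theorem four_dvd_primesEquiv_sub_one_of_mem_rootsOfUnityFixer_four {q : HeightOneSpectrum (𝓞 ℚ)}
    (hq2 : ((2 : ℕ) : 𝓞 ℚ) ∉ q.asIdeal) {𝔓 : Ideal (absIntegers (𝓞 ℚ) ℚ)} (h𝔓 : 𝔓 ∈ q.primesAbove)
    {Fr : absoluteGaloisGroup ℚ} (hFr : IsArithFrobAt (𝓞 ℚ) Fr 𝔓) (h4 : Fr ∈ rootsOfUnityFixer ℚ 4) :
    4 ∣ ((primesEquiv q : Nat.Primes) : ℕ) - 1 := by
  haveI : NeZero ((4 : ℕ) : ℚ) := ⟨by norm_num⟩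
  have hℓ : ((primesEquiv q : Nat.Primes) : ℕ).Prime := (primesEquiv q).2
  have hne : ((primesEquiv q : Nat.Primes) : ℕ) ≠ 2 := by
    -- `ℓ = 2` would put `2` in `q` (`ℓ` generates `q ∩ ℤ`)
    intro h
    apply hq2
    have hdvd : natGenerator q ∣ 2 := by
      change ((primesEquiv q : Nat.Primes) : ℕ) ∣ 2
      rw [h]
    have hmem := (natGenerator_dvd_iff q).mp hdvd
    rw [← map_natCast (Rat.IsIntegralClosure.intEquiv (𝓞 ℚ)) 2] at hmem
    exact Ideal.apply_mem_of_equiv_iff.mp hmem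
  have hN : ((4 : ℕ) : absIntegers (𝓞 ℚ) ℚ) ∉ 𝔓 := by
    refine Rat.natCast_not_mem_of_mem_primesAbove_of_not_dvd h𝔓 fun h => hne ?_
    have h' : ((primesEquiv q : Nat.Primes) : ℕ) ∣ 2 * 2 := by simpa using h
    rcases (Nat.Prime.dvd_mul hℓ).mp h' with h2 | h2 <;>
      exact (Nat.prime_dvd_prime_iff_eq hℓ Nat.prime_two).mp h2
  have hχ := modNCyclotomicCharacter_eq_residueCard_of_isArithFrobAt (N := 4) h𝔓 hN hFr
  rw [rootsOfUnityFixer_eq_ker, MonoidHom.mem_ker] at h4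
  rw [h4, Units.val_one, residueCard_eq_coe_primesEquiv] at hχ
  have hmod : ((primesEquiv q : Nat.Primes) : ℕ) ≡ 1 [MOD 4] :=
    (ZMod.natCast_eq_natCast_iff _ _ _).mp (by rw [Nat.cast_one]; exact hχ.symm)
  exact (Nat.modEq_iff_dvd' hℓ.one_lt.le).mp hmod.symm

end MuFour

/-! ## §2 Index-2 descent of the Steinberg–Sah input to `Gal(ℚ̄/ℚ(i))` -/

section Descent

variable (W : WeierstrassCurve ℚ) [W.IsElliptic] (κ : ZpExtension ℚ 2)

/-- **Index-2 descent.** For `ρ̄_{E,2}` onto (and a transposition `τ ∈ ker κ`, used only to produce a `3`-cycle in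
`Γ_ℚ`) and a continuous `1`-cocycle `φ₀` of `E[2]` that does not vanish on `M = ker ρ̄₂ ⊓ ker κ`: `φ₀` does not vanish on
`M ⊓ Gal(ℚ̄/ℚ(i))`. Proof: `φ₀|_M` is a `Γ_ℚ`-equivariant homomorphism on a normal subgroup acting trivially; if it
vanished on the index-`≤ 2` subgroup `M ⊓ Gal(ℚ̄/ℚ(i))` its values would be `{0, v}` with `v = φ₀(ν₁) ≠ 0`, so `v`
would be fixed by every `g ∈ Γ_ℚ` (`g • v = φ₀(g ν₁ g⁻¹) ∈ {0, v} ∖ {0}`) — but a `3`-cycle of `E[2]` moves `v`.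
[cite: MazurRubin2004, §3.6] [cite: SerreLocalFields1979, VII §5 Prop. 3] -/
theorem exists_mem_inf_rootsOfUnityFixer_four_apply_ne_zero (h2 : W.HasSurjectiveModNGaloisRep 2)
    {τ : absoluteGaloisGroup ℚ} (hτκ : τ ∈ κ.kerSubgroup)
    (hsign : Equiv.Perm.sign (permGal W (two_ne_zero : (2 : ℚ) ≠ 0) τ) = -1)
    (φ₀ : contOneCocycles (W.torsionGaloisModule (2 : ℤ)).toTopRep)
    (hφ₀ : ∃ ν ∈ (galoisRepTorsion W 2).ker ⊓ κ.kerSubgroup, φ₀.1 ν ≠ 0) :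
    ∃ ν ∈ (galoisRepTorsion W 2).ker ⊓ κ.kerSubgroup ⊓ rootsOfUnityFixer ℚ 4, φ₀.1 ν ≠ 0 := by
  obtain ⟨ν₁, hν₁, hv⟩ := hφ₀
  by_contra hcon
  push Not at hcon
  set M : Subgroup (absoluteGaloisGroup ℚ) := (galoisRepTorsion W 2).ker ⊓ κ.kerSubgroup with hM
  haveI hMn : M.Normal := Subgroup.normal_inf_normal _ _
  have hMV : ∀ m ∈ M, ∀ x : (W.torsionGaloisModule (2 : ℤ)).toTopRep,
      (W.torsionGaloisModule (2 : ℤ)).toTopRep.ρ m x = x :=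
    fun m hm x => (mem_ker_galoisRepTorsion_two_iff W m).mp (Subgroup.mem_inf.mp hm).1 x
  have hν₁F : ν₁ ∉ rootsOfUnityFixer ℚ 4 := fun h => hv (hcon ν₁ (Subgroup.mem_inf.mpr ⟨hν₁, h⟩))
  -- (a) on `M` the values of `φ₀` are `0` or `v := φ₀ ν₁`
  have hval : ∀ m ∈ M, φ₀.1 m = 0 ∨ φ₀.1 m = φ₀.1 ν₁ := by
    intro m hm
    by_cases hmF : m ∈ rootsOfUnityFixer ℚ 4
    · exact Or.inl (hcon m (Subgroup.mem_inf.mpr ⟨hm, hmF⟩))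
    · right
      have hqF : m * ν₁⁻¹ ∈ rootsOfUnityFixer ℚ 4 := mul_inv_mem_rootsOfUnityFixer_four_of_not_mem hmF hν₁F
      have hqM : m * ν₁⁻¹ ∈ M := M.mul_mem hm (M.inv_mem hν₁)
      have h0 : φ₀.1 (m * ν₁⁻¹) = 0 := hcon _ (Subgroup.mem_inf.mpr ⟨hqM, hqF⟩)
      calc φ₀.1 m = φ₀.1 (m * ν₁⁻¹ * ν₁) := by rw [inv_mul_cancel_right]
        _ = φ₀.1 (m * ν₁⁻¹) + φ₀.1 ν₁ := contOneCocycles.apply_mul_of_fixed φ₀ (hMV _ hqM) ν₁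
        _ = φ₀.1 ν₁ := by rw [h0, zero_add]
  -- (b) `v` is fixed by `Γ_ℚ`
  have hfix : ∀ g : absoluteGaloisGroup ℚ, g • φ₀.1 ν₁ = φ₀.1 ν₁ := by
    intro g
    have hconj : φ₀.1 (g * ν₁ * g⁻¹) = g • φ₀.1 ν₁ :=
      contOneCocycles.apply_conj_of_fixed φ₀ (hMV ν₁ hν₁) g
    have hmem : g * ν₁ * g⁻¹ ∈ M := hMn.conj_mem ν₁ hν₁ g
    rcases hval _ hmem with h0 | h1
    · exfalso
      apply hv
      rw [hconj] at h0
      exact (smul_eq_zero_iff_eq g).mp h0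
    · rw [← hconj, h1]
  -- (c) a `3`-cycle moves `v ≠ 0`
  obtain ⟨σ₀, -, hσ₀⟩ := exists_mem_kerSubgroup_forall_smul_ne W κ h2 hτκ hsign
  exact hσ₀ _ hv (hfix σ₀)

end Descent

end Summit.BirchSwinnertonDyer.BirchSwinnertonDyer.Theorems.SteinbergFibreAtTwo

end
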